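import Literature.MathematicalPhysics.QuantumFieldTheory.Balaban1983to89.Node00.Record5
import Literature.MathematicalPhysics.QuantumFieldTheory.Balaban1983to89.B9LeafKnitNonVacuity
import Literature.MathematicalPhysics.QuantumFieldTheory.Balaban1983to89.B10Eq29TubeLine

/-!
# `Balaban1983to89.B9LeafUnpinnedRecord5` — DAG node N06 · [Balaban1985BackgroundPropagators] at NODE 00's STAGE-5 RECORD PREDICATE
# `Node00.IsRecordOfRecord₅`: the [B9] bundle is still a FREE residual field (`Residual₅.Y`), so N06 is UNDETERMINED over the Stage-5 records —
# true at every run of one record, false (given N03's antecedents) at every run of another; the kernel form of «a B9-PINNING stage is required before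
# `stub_N06` is typed over the record» (R422 ∕ the chair's rev-1 soundness test R433), companion of `…B9LeafUnpinned` (Stages 2–3) and
# `…B9LeafKnitNonVacuity` (the positive degenerate witness)

B9 = T. Bałaban, *Propagators for lattice gauge theories in a background field*, Commun. Math. Phys. **99** (1985) 389–434
[Balaban1985BackgroundPropagators]; the record predicate is NODE 00's (`Node00.Record5`, seat pub-ymgap-node00-def g28, p410529):
`IsRecordOfRecord₅ F N D w := ∃ θ : Stage5Params F N, θ.Admissible ∧ D = datumOfRecord₅ F N θ ∧ w.C = D.C ∧ w.γ = θ.γ ∧ w.L = θ.L ∧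
∀ P, w.up P = upOfRecord₅ F N θ P`, with `upOfRecord₅ θ P = Upstream.ofPrintedAllXPN (carriers₃ θ.toStage3Params (θ.res.X P)) (θ.res.Y P) …` and
`θ.res : Residual₅ F N` a structure of NAMED, UNCONSTRAINED residual objects — among them the run-indexed [B9] carriers `Y`.

YM-PLAN Track A, node N06 (`Dag.B9_main ℓ := ℓ.b4 → ℓ.b5 → ℓ.b6 → ℓ.b7 → ℓ.b9`; leaf `b9 ↦ DagBinding.B9LeafX Y`).  Seat `pub-ymgap-dag-n06-a` (g2).
THEOREMS ONLY (0 `def`, 0 `sorry`, standard axioms); every witness is built inside the proofs.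

## WHAT IS CERTIFIED (kernel bookkeeping over NODE 00's Stage-5 predicate; nothing about Bałaban's objects)

* §0 `exists_isRecordOfRecord₅_b9_iff` — for EVERY four-torus family `F`, every `N ≥ 1` and EVERY bundle `Y : PrintedCarriers9X` there is a Stage-5
  record `(D, w)` (admissible Stage-3 parameters as in `B9LeafUnpinned` §3, `γ := 1`, the residual objects trivial — zero β-functions, empty
  domains, `R := id`, clauses `False` — and `res.Y := fun _ => Y`) at which the run's `b9` leaf IS `B9LeafX Y` for every run: the record predicate
  lets the prover of a `∀ (D, w)`-clause meet ANY [B9] bundle.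
* §1 `exists_isRecordOfRecord₅_b6_main_imp_not_b9_main` — with `Y :=` the refuting bundle of `B9LeafUnpinned.exists_not_b9LeafX`: a Stage-5 record at
  which, for every run, N03 (`Dag.B6_main`) IMPLIES `¬` N06 (b4, b5, b7 hold at every record by `Node00.b4∕b5∕b7_main_of_isRecordOfRecord₅`); hence
  `not_b6_and_b9_main_over_record₅` and `not_b9_main_over_record₅_of_b6_main` (were N03 closed over the Stage-5 records, N06 would be REFUTABLE over them).
* §2 `exists_isRecordOfRecord₅_b9_main` — with `Y :=` the degenerate bundle of `B9LeafKnitNonVacuity.exists_b9LeafX_of_vanishing_operators` (inhabited,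
  `M` unbounded, operators `≡ 0`): a Stage-5 record at which `b9`, hence N06, HOLDS at every run.
* §3 `b9_main_undetermined_over_record₅` — the conjunction: N06 is undetermined over `IsRecordOfRecord₅`.  CONSEQUENCE FOR THE RESTATEMENT (plan ∕
  node00-def ∕ chair): a crux or stub reading «`∀ D w, IsRecordOfRecord₅ F N D w → ∀ P, Dag.B9_main (leavesP w P)`» is refutable as typed, and its
  `∃`-dual is junk-provable; the [B9] group must be PINNED (a function `Y9OfRecord θ` of genuine parameters, knit seat's design note
  `B9-PIN-DESIGN-g2.md`) before N06 is typed over a record predicate.  The same holds verbatim for the ₅C variant (`upOfRecord₅C` re-binds only `b10`).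

HONEST FRAMING: count-neutral; N06 NOT discharged; nothing asserted about [B9] at Bałaban's objects; one finite T⁴ programme at fixed ε; nothing continuum ∕
ℝ⁴ ∕ OS ∕ mass-gap ∕ Clay.

EDITION 2026-08-29 (director-ym №268 (4), SECOND RING of the record-abelian repair FLAG №14): the ∃-witness literal of `exists_isRecordOfRecord₅_b9_iff` re-keyed from the scalar placeholder `𝔸 := ℂ` to the record carrier `𝔸 := Matrix (Fin 2) (Fin 2) ℂ` (C⋆-structure `B10Eq29TubeLine.cstarAlgebraMatrix 2`, the carrier of `Node00.stage3OfRecord₁₂` since the FLAG №14 edition of `Node00.Record12Numerics`); the proofs are carrier-blind and NO statement changes (none of them exposes `𝔸`); one import added (`B10Eq29TubeLine`, cycle-free); count-neutral bookkeeping, nothing continuum ∕ OS ∕ mass-gap.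
-/

noncomputable section

namespace Literature.MathematicalPhysics.QuantumFieldTheory.Balaban1983to89.B9LeafUnpinnedRecord5

open DagBinding DagDischargedII

variable (F : T4Continuum.T4Family) (N : ℕ) [NeZero N]

/-! ## §0 A Stage-5 record around an arbitrary [B9] bundle -/

/-- **Every [B9] bundle occurs at some Stage-5 record**: for any `Y` there is `(D, w)` with `Node00.IsRecordOfRecord₅ F N D w` and
`(leavesP w P).b9 ↔ B9LeafX Y` at every run (the residual field `Residual₅.Y` is unconstrained; the other residual objects are the trivial ones, the
Stage-3 parameters those of `B9LeafUnpinned` §3, `γ := 1`). [cite: Balaban1985BackgroundPropagators, Thms 3.1–3.15 pp.397–432 (bookkeeping over NODE 00's Stage-5 record predicate)] -/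
theorem exists_isRecordOfRecord₅_b9_iff (Y : PrintedCarriers9X) :
    ∃ (D : T4Continuum.FiniteEpsData F (Node00.SU N)) (w : WorldP), Node00.IsRecordOfRecord₅ F N D w ∧
      ∀ P : B12.RunParams, ((leavesP w P).b9 ↔ B9LeafX Y) := by
  obtain ⟨θ, hθ, hD⟩ := Node00.Stage1Params.exists_admissible
  obtain ⟨X⟩ := Node00.nonempty_printedCarriersR
  obtain ⟨Z⟩ := Node00.nonempty_printedCarriers11
  obtain ⟨V⟩ := Node00.nonempty_printedCarriers14R
  obtain ⟨W⟩ := Node00.nonempty_printedCarriers15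
  obtain ⟨w₀⟩ := Node00.nonempty_worldP
  have hL1 : 1 ≤ θ.L := le_of_lt θ.hL.2
  have hℓ : (θ.L - 1 : ℕ) + 1 = θ.L := Nat.sub_add_cancel hL1
  let θ₃ : Node00.Stage3Params :=
    { θ with
      𝔸 := Matrix (Fin 2) (Fin 2) ℂ, instCStar := B10Eq29TubeLine.cstarAlgebraMatrix 2, instNontrivial := inferInstance, d₆ := 3, ℓ₆ := θ.L - 1, hd₆ := by rw [hD], hℓ₆ := hℓ, b₀ := 1, b₁ := 1, hb := ⟨one_pos, le_rfl⟩
      δ₀ := 2 / (((θ.L - 1 : ℕ) : ℝ) + 1), hδ₀ := ⟨by positivity, le_rfl⟩ }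
  let res : Node00.Residual₅ F N :=
    { X := fun _ => X, Y := fun _ => Y, Z := fun _ => Z, V := fun _ => V, W := fun _ => W, βfun := fun _ _ => 0, E := fun _ => 0,
      dom := fun _ _ => ∅, effAction := fun _ _ _ => 0, wilsonBG := fun _ _ _ => 0, Ek := fun _ _ _ => 0, χ := fun _ _ _ => 0,
      S218 := fun _ _ _ => False, ReprA := fun _ _ _ _ _ _ _ => False, IndA := fun _ _ _ _ _ _ _ => False, R := fun _ _ => id,
      preservesIntegral_R := fun _ _ _ _ => rfl, integrable_R := fun _ _ _ _ h => h }
  let θ₅ : Node00.Stage5Params F N := { θ₃ with γ := 1, res := res }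
  have hθ₅ : θ₅.Admissible := ⟨hθ, one_pos⟩
  let w : WorldP :=
    { w₀ with
      C := (Node00.datumOfRecord₅ F N θ₅).C, γ := θ₅.γ, L := (θ₅.L : ℝ), one_lt_L := by exact_mod_cast θ.hL.2
      up := fun P => Node00.upOfRecord₅ F N θ₅ P }
  refine ⟨Node00.datumOfRecord₅ F N θ₅, w, Node00.isRecordOfRecord₅_of_eq F N θ₅ hθ₅ w rfl rfl rfl (fun _ => rfl), fun P => ?_⟩
  exact B9LeafKnit.leavesP_b9_iff (rfl : w.up P = Upstream.ofPrintedAllXPN (Node00.carriers₃ θ₅.toStage3Params X) Y Z V W)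

/-! ## §1 Given N03's antecedents, N06 FAILS at some Stage-5 record -/

/-- **At some Stage-5 record, N03 implies `¬` N06 for every run**: the record of §0 around the refuting bundle of `B9LeafUnpinned.exists_not_b9LeafX`
(inhabited index, `M = n` unbounded, norms `0`, a sup entry `1`); `b4`, `b5`, `b7` hold at every Stage-5 record (`Node00.b4∕b5∕b7_main_of_isRecordOfRecord₅`),
so `Dag.B6_main` supplies `b6` and `Dag.B9_main` would force the false leaf. [cite: Balaban1985BackgroundPropagators, Thm 3.1 (3.42) p.397 (bookkeeping: the typed statement over a degenerate bundle at a Stage-5 record)] -/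
theorem exists_isRecordOfRecord₅_b6_main_imp_not_b9_main :
    ∃ (D : T4Continuum.FiniteEpsData F (Node00.SU N)) (w : WorldP), Node00.IsRecordOfRecord₅ F N D w ∧
      ∀ P : B12.RunParams, Dag.B6_main (leavesP w P) → ¬ Dag.B9_main (leavesP w P) := by
  obtain ⟨Y, -, hY⟩ := B9LeafUnpinned.exists_not_b9LeafX
  obtain ⟨D, w, hrec, hb9⟩ := exists_isRecordOfRecord₅_b9_iff F N Y
  refine ⟨D, w, hrec, fun P h6 h9 => hY ?_⟩
  have h4 : (leavesP w P).b4 := Node00.b4_main_of_isRecordOfRecord₅ hrec P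
  have h5 : (leavesP w P).b5 := Node00.b5_main_of_isRecordOfRecord₅ hrec P h4
  have h7 : (leavesP w P).b7 := Node00.b7_main_of_isRecordOfRecord₅ hrec P h5
  exact (hb9 P).1 (h9 h4 h5 (h6 h4 h5) h7)

/-- **Hence the Stage-5 record predicate cannot carry N03 ∧ N06** (the first two nodes of the K2 cluster «FlowBounds») at all its records.
[cite: Balaban1985BackgroundPropagators, Thms 3.1–3.15 pp.397–432 (bookkeeping)] -/
theorem not_b6_and_b9_main_over_record₅ :
    ¬ ∀ (D : T4Continuum.FiniteEpsData F (Node00.SU N)) (w : WorldP), Node00.IsRecordOfRecord₅ F N D w →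
      ∀ P : B12.RunParams, Dag.B6_main (leavesP w P) ∧ Dag.B9_main (leavesP w P) := by
  obtain ⟨D, w, hrec, h⟩ := exists_isRecordOfRecord₅_b6_main_imp_not_b9_main F N
  exact fun hall => h ⟨0, 0, 0⟩ (hall D w hrec ⟨0, 0, 0⟩).1 (hall D w hrec ⟨0, 0, 0⟩).2

/-- **Were N03 closed over the Stage-5 records, N06 would be REFUTABLE over them** — the sharp form of «`stub_N06` must not be typed over
`IsRecordOfRecord₅`». [cite: Balaban1985BackgroundPropagators, Thms 3.1–3.15 pp.397–432 (bookkeeping)] -/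
theorem not_b9_main_over_record₅_of_b6_main
    (h6 : ∀ (D : T4Continuum.FiniteEpsData F (Node00.SU N)) (w : WorldP), Node00.IsRecordOfRecord₅ F N D w →
      ∀ P : B12.RunParams, Dag.B6_main (leavesP w P)) :
    ¬ ∀ (D : T4Continuum.FiniteEpsData F (Node00.SU N)) (w : WorldP), Node00.IsRecordOfRecord₅ F N D w →
      ∀ P : B12.RunParams, Dag.B9_main (leavesP w P) := by
  obtain ⟨D, w, hrec, h⟩ := exists_isRecordOfRecord₅_b6_main_imp_not_b9_main F N
  exact fun hall => h ⟨0, 0, 0⟩ (h6 D w hrec ⟨0, 0, 0⟩) (hall D w hrec ⟨0, 0, 0⟩)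

/-! ## §2 N06 HOLDS at some Stage-5 record -/

/-- **At some Stage-5 record, the `b9` leaf — hence N06 — holds at every run**: the record of §0 around the degenerate bundle of
`B9LeafKnitNonVacuity.exists_b9LeafX_of_vanishing_operators` (inhabited index, `M` unbounded, operator entries `≡ 0`, at which the whole extended leaf
holds). [cite: Balaban1985BackgroundPropagators, Thms 3.1–3.15 pp.397–432 (bookkeeping: the typed leaf over a degenerate bundle at a Stage-5 record)] -/
theorem exists_isRecordOfRecord₅_b9_main :
    ∃ (D : T4Continuum.FiniteEpsData F (Node00.SU N)) (w : WorldP), Node00.IsRecordOfRecord₅ F N D w ∧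
      ∀ P : B12.RunParams, (leavesP w P).b9 ∧ Dag.B9_main (leavesP w P) := by
  obtain ⟨Y, -, -, -, hY⟩ := B9LeafKnitNonVacuity.exists_b9LeafX_of_vanishing_operators
  obtain ⟨D, w, hrec, hb9⟩ := exists_isRecordOfRecord₅_b9_iff F N Y
  exact ⟨D, w, hrec, fun P => ⟨(hb9 P).2 hY, B9LeafKnit.b9_main_of_b9 ((hb9 P).2 hY)⟩⟩

/-! ## §3 N06 is undetermined over the Stage-5 record predicate -/

/-- **N06 is UNDETERMINED over NODE 00's Stage-5 records**: it holds at every run of one record (§2) and fails — given N03's antecedents — at every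
run of another (§1).  Neither «`∀ D w, IsRecordOfRecord₅ F N D w → ∀ P, Dag.B9_main (leavesP w P)`» nor its negation-free `∃`-dual carries content;
the [B9] group must be pinned as a function of genuine parameters before N06 is typed over a record (`B9LeafKnit.b9_main_of_pinnedB9` is the shape).
[cite: Balaban1985BackgroundPropagators, Thms 3.1–3.15 pp.397–432 (bookkeeping: independence of the typed node over the Stage-5 record predicate)] -/
theorem b9_main_undetermined_over_record₅ :
    (∃ (D : T4Continuum.FiniteEpsData F (Node00.SU N)) (w : WorldP), Node00.IsRecordOfRecord₅ F N D w ∧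
      ∀ P : B12.RunParams, Dag.B9_main (leavesP w P)) ∧
    (∃ (D : T4Continuum.FiniteEpsData F (Node00.SU N)) (w : WorldP), Node00.IsRecordOfRecord₅ F N D w ∧
      ∀ P : B12.RunParams, Dag.B6_main (leavesP w P) → ¬ Dag.B9_main (leavesP w P)) := by
  obtain ⟨D, w, hrec, h⟩ := exists_isRecordOfRecord₅_b9_main F N
  exact ⟨⟨D, w, hrec, fun P => (h P).2⟩, exists_isRecordOfRecord₅_b6_main_imp_not_b9_main F N⟩

end Literature.MathematicalPhysics.QuantumFieldTheory.Balaban1983to89.B9LeafUnpinnedRecord5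

end
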